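import Summits.NavierStokesRegularity.NavierStokesRegularity.Theorems.ScenarioCensusRowF1SocketKill
import Summits.NavierStokesRegularity.NavierStokesRegularity.Theorems.ScenarioCensusRowF1IntStretchBudget
import HarnessLib

/-!
# LINE 27 «liouville-socket» port, part 4/5: §11 the criterion rows `Row_F1sp` / `Row_F1xf`, the floors `DivergentSpeedExcess` / `DivergentCrossFlowExcess`, the residual
# `SocketSlack` (≡ `Row_F1`), the dictionary, the verdicts `rowF1sp_holds` / `rowF1xf_holds`, `socketSlack_iff_rowF1`

Re-homed for the scenario census (typer seat ns-census-typer-1 g9; the cells F1sp / F1vol / F1xf and the floors DSE / DFV / DXE are MEMBERS OF RECORD «DECIDED IN KERNEL IN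
FILES» of row F1 since census v1.80 (critic idea-crit-3 g8 PASS — no price; ref ns-census-ref g11 PRE-CHECK ✓ §16.2 item 48; lead-presearch label); this port makes them
TREE-decided): VERBATIM PORT of ns-idea-3 LINE 27 «liouville-socket», `pub/ideators/ns-idea-3/lines/liouville-socket/line-liouville-socket.lean` sha16 01bcb6dd501a8321
(1929 l., lean check rc 0, 0 sorry), split for the 400-line rule into five parts `ScenarioCensusRowF1Socket{∅, Readout, Kill, Rows, Top}` (chain imports).  Lean text
VERBATIM in namespace `…Theorems.ScenarioCensus.LiouvilleSocket` (the line's `…Cruxes.ScenarioCensusRowF1.LiouvilleSocketLine` re-homed); port edits: the bracket lines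
`section …` / `end …` dropped (no `variable`s), `@[conjecture]` on the residual `SocketSlack` (≡ `ScenarioCensus.Row_F1`, OPEN), one-line docstrings added where missing
(gate lint); after review p713151 three one-line helpers (`le_of_sq_le_sq'`, `cross_zero_left`, `continuous_cross₂`) are replaced by Mathlib's `le_of_sq_le_sq` / local `have`s and `cross_smul_smul` is the tree's `UnthreadedRigidity.ThreadingJets.cross_smul_smul` BY NAME; lemmas the line shares VERBATIM with the landed inviscid-top / frozen-top / columnar-top / stretched-top / integrated-stretch ports are taken BY NAME (listed
below).  Statements untouched.

No census VALUE is moved here (row F1 stays OPEN-WITH-LINE; the members become TREE-decided by name); NS regularity is NOT proved; `Row_F1` is untouched (zero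
movement, `socketSlack_iff_rowF1`); no summit statement is proved by this file. Lemmas that restate already-landed tree declarations are taken BY NAME (gate lint `dedup.landed`): `fderiv_smul_stPull_apply` = `InviscidTop.fderiv_smul_stPull_apply`, `fderiv_smul_stPull` = `InviscidTop.fderiv_smul_stPull`, `fderiv_fderiv_smul_stPull` = `InviscidTop.fderiv_fderiv_smul_stPull`, `tendsto_clm_of_tendsto_apply` = `InviscidTop.tendsto_clm_of_tendsto_apply`, `tendsto_fderiv_fderiv_apply_of_bound` = `InviscidTop.tendsto_fderiv_fderiv_apply_of_bound`, `tendsto_fderiv_fderiv_of_bound` = `InviscidTop.tendsto_fderiv_fderiv_of_bound`, `tendsto_fderiv_fderiv_of_typeI_seq_Ioo` = `InviscidTop.tendsto_fderiv_fderiv_of_typeI_seq_Ioo`, `fderiv3_smul_stPull` = `FrozenTop.fderiv3_smul_stPull`, `tendsto_fderiv3_of_typeI_seq_Ioo` = `FrozenTop.tendsto_fderiv3_of_typeI_seq_Ioo`, `tendsto_physicalTime` = `ColumnarTop.tendsto_physicalTime`, `eventually_fast` = `ColumnarTop.eventually_fast`, `sqrt_timeLag` = `StretchedTop.sqrt_timeLag`,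 `forall_of_forall_ne_zero` = `StretchedTop.forall_of_forall_ne_zero`, `radius_eq` = `FrozenTop.radius_eq`, `jointCond_everywhere₆` = `FrozenTop.jointCond_everywhere₄`, `continuousOn_quad` = `IntegratedStretch.continuousOn_quad`, `sqrt_nu_timeLag` = `IntegratedStretch.sqrt_nu_timeLag`, `sing_of_not_bounded` = `InviscidTop.sing_of_not_bounded`, `exists_singularZoom_package₃` = `FrozenTop.exists_singularZoom_package₃`, `lapD_eq_zero_of_eq_zero` = `FrozenTop.lapD_eq_zero_of_eq_zero`, `measurableSet_top` = `IntegratedStretch.measurableSet_top`, `cross_smul_smul` = `UnthreadedRigidity.ThreadingJets.cross_smul_smul`.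
-/

-- the summit and its single problem share the name `NavierStokesRegularity` (D-0017 nested layout)
set_option linter.dupNamespace false

noncomputable section

open MeasureTheory Set Function Filter TopologicalSpace Metric
open scoped Topology NNReal ENNReal InnerProductSpace RealInnerProductSpace Laplacian

namespace Summit.NavierStokesRegularity.NavierStokesRegularity.Theorems.ScenarioCensus.LiouvilleSocket

open Literature.Analysis Literature.Analysis.FluidPDE
open Summit.NavierStokesRegularity.NavierStokesRegularity.Theorems

/-! ## §11 THE TWO NEW CRITERION ROWS `F1sp` (speed excess, order 0) and `F1xf` (cross-flow excess, order 1), their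
FLOORS, the residual, the split toward `Row_F1` BY NAME; corollaries in kernel: the eventual threshold rows, the
SCALE-INVARIANT VOLUME row `F1vol` and its floor («a Type-I Clay blow-up spends INFINITE scale-invariant space–time
volume above every fixed fraction of the self-similar speed»), the near-Beltrami-top corner -/

/-- The number of row F1sp — the **SPEED-EXCESS INTEGRAND OF THE FAST FLUID** on `[t₀, T)` (order 0: the velocity
value only): `𝟙{t ∈ [t₀,T), Λ(t) < |u(t,x)|} · √(T − t) · max(0, (T − t)⁻² (|u|² − κ ν/(T − t)))`. -/
def spdIntegrand (T ν κ t₀ : ℝ) (Λ : ℝ → ℝ) (u : ℝ → E3 → E3) : ℝ × E3 → ℝ≥0∞ :=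
  {z : ℝ × E3 | z.1 ∈ Ico t₀ T ∧ Λ z.1 < ‖u z.1 z.2‖}.indicator fun z =>
    ENNReal.ofReal (Real.sqrt (T - z.1) *
      max 0 (((T - z.1) ^ 2)⁻¹ * (‖u z.1 z.2‖ ^ 2 - κ * (ν * (T - z.1)⁻¹))))

/-- The number of row F1xf — the **CROSS-FLOW-EXCESS INTEGRAND OF THE FAST FLUID** on `[t₀, T)` (order 1: velocity
and vorticity only): `𝟙{t ∈ [t₀,T), Λ(t) < |u(t,x)|} · √(T − t) · max(0, ‖ω × u‖² − κ ν |ω|²/(T − t))`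
(`‖ω × u‖² = |ω|² |u_⊥|²`, `u_⊥` = the velocity component across the vorticity). -/
def xflIntegrand (T ν κ t₀ : ℝ) (Λ : ℝ → ℝ) (u : ℝ → E3 → E3) : ℝ × E3 → ℝ≥0∞ :=
  {z : ℝ × E3 | z.1 ∈ Ico t₀ T ∧ Λ z.1 < ‖u z.1 z.2‖}.indicator fun z =>
    ENNReal.ofReal (Real.sqrt (T - z.1) *
      max 0 (‖cross (curl (u z.1) z.2) (u z.1 z.2)‖ ^ 2 - κ * (ν * (T - z.1)⁻¹ * ‖curl (u z.1) z.2‖ ^ 2)))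

/-- **Criterion row F1sp** (the exact frame of `Row_F1` plus ONE hypothesis: for some `κ < 1`, some `t₀ ∈ [0, T)` and
some MEASURABLE subcritical level, the speed excess of the fast fluid over the fraction `κ` of the squared self-similar
speed `ν/(T − t)` is integrable against `√(T − t) (T − t)⁻²` on `[t₀, T) × ℝ³`).  PROVED (`rowF1sp_holds`). -/
def Row_F1sp : Prop :=
  ∀ (ν T : ℝ), 0 < ν → 0 < T → ∀ (u : ℝ → E3 → E3) (p : ℝ → E3 → ℝ),
    IsClassicalNSSolutionOn (Ico 0 T) ν 0 u p → IsLerayHopfOn T ν 0 (u 0) u →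
    HasRapidSpatialDecay (u 0) → IsTypeIBlowup u T →
    (∃ (κ t₀ : ℝ) (Λ : ℝ → ℝ), κ < 1 ∧ 0 ≤ t₀ ∧ t₀ < T ∧ IsSubcriticalLevel T Λ ∧ Measurable Λ ∧
      ∫⁻ z, spdIntegrand T ν κ t₀ Λ u z < ⊤) →
    HasSmoothExtensionPast ν 0 u T

/-- **Criterion row F1xf** (the frame of `Row_F1` plus: for some `κ < 1`, `t₀ ∈ [0, T)` and some measurable
subcritical level, the enstrophy-weighted cross-flow excess of the fast fluid is integrable against `√(T − t)` on
`[t₀, T) × ℝ³`).  PROVED (`rowF1xf_holds`). -/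
def Row_F1xf : Prop :=
  ∀ (ν T : ℝ), 0 < ν → 0 < T → ∀ (u : ℝ → E3 → E3) (p : ℝ → E3 → ℝ),
    IsClassicalNSSolutionOn (Ico 0 T) ν 0 u p → IsLerayHopfOn T ν 0 (u 0) u →
    HasRapidSpatialDecay (u 0) → IsTypeIBlowup u T →
    (∃ (κ t₀ : ℝ) (Λ : ℝ → ℝ), κ < 1 ∧ 0 ≤ t₀ ∧ t₀ < T ∧ IsSubcriticalLevel T Λ ∧ Measurable Λ ∧
      ∫⁻ z, xflIntegrand T ν κ t₀ Λ u z < ⊤) →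
    HasSmoothExtensionPast ν 0 u T

/-- **DIVERGENT SPEED EXCESS** (structural floor, maximal frame): for a maximal Type-I Clay blow-up, EVERY `κ < 1`,
every `t₀ ∈ [0, T)` and every measurable subcritical level give
`∬_{[t₀,T), |u| > Λ(t)} √(T − t) (T − t)⁻² [|u|² − κν/(T − t)]₊ dx dt = ∞`.  PROVED (`divergentSpeedExcess_holds`). -/
def DivergentSpeedExcess : Prop :=
  ∀ (ν T : ℝ), 0 < ν → 0 < T → ∀ (u : ℝ → E3 → E3) (p : ℝ → E3 → ℝ),
    IsMaximalSmoothSolution ν 0 u p T → IsLerayHopfOn T ν 0 (u 0) u →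
    HasRapidSpatialDecay (u 0) → IsTypeIBlowup u T →
    ∀ κ : ℝ, κ < 1 → ∀ t₀ : ℝ, 0 ≤ t₀ → t₀ < T →
    ∀ Λ : ℝ → ℝ, IsSubcriticalLevel T Λ → Measurable Λ → ∫⁻ z, spdIntegrand T ν κ t₀ Λ u z = ⊤

/-- **DIVERGENT CROSS-FLOW EXCESS** (structural floor, maximal frame): for a maximal Type-I Clay blow-up, EVERY
`κ < 1`, every `t₀ ∈ [0, T)` and every measurable subcritical level give
`∬_{[t₀,T), |u| > Λ(t)} √(T − t) [‖ω × u‖² − κν|ω|²/(T − t)]₊ dx dt = ∞`.  PROVED (`divergentCrossFlowExcess_holds`). -/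
def DivergentCrossFlowExcess : Prop :=
  ∀ (ν T : ℝ), 0 < ν → 0 < T → ∀ (u : ℝ → E3 → E3) (p : ℝ → E3 → ℝ),
    IsMaximalSmoothSolution ν 0 u p T → IsLerayHopfOn T ν 0 (u 0) u →
    HasRapidSpatialDecay (u 0) → IsTypeIBlowup u T →
    ∀ κ : ℝ, κ < 1 → ∀ t₀ : ℝ, 0 ≤ t₀ → t₀ < T →
    ∀ Λ : ℝ → ℝ, IsSubcriticalLevel T Λ → Measurable Λ → ∫⁻ z, xflIntegrand T ν κ t₀ Λ u z = ⊤

/-- **Residual** (maximal frame): every maximal Type-I Clay blow-up has, for some `κ < 1`, `t₀`, measurable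
subcritical level, an integrable speed excess OR an integrable cross-flow excess.  DECLARED ≡ row F1
(`socketSlack_iff_rowF1`); no movement on `Row_F1` is claimed. -/
@[conjecture] def SocketSlack : Prop :=
  ∀ (ν T : ℝ), 0 < ν → 0 < T → ∀ (u : ℝ → E3 → E3) (p : ℝ → E3 → ℝ),
    IsMaximalSmoothSolution ν 0 u p T → IsLerayHopfOn T ν 0 (u 0) u →
    HasRapidSpatialDecay (u 0) → IsTypeIBlowup u T →
    (∃ (κ t₀ : ℝ) (Λ : ℝ → ℝ), κ < 1 ∧ 0 ≤ t₀ ∧ t₀ < T ∧ IsSubcriticalLevel T Λ ∧ Measurable Λ ∧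
      ∫⁻ z, spdIntegrand T ν κ t₀ Λ u z < ⊤) ∨
    (∃ (κ t₀ : ℝ) (Λ : ℝ → ℝ), κ < 1 ∧ 0 ≤ t₀ ∧ t₀ < T ∧ IsSubcriticalLevel T Λ ∧ Measurable Λ ∧
      ∫⁻ z, xflIntegrand T ν κ t₀ Λ u z < ⊤)

/-- **The split**: the two criterion rows + the residual ⇒ row F1. -/
theorem rowF1_of (hS : Row_F1sp) (hX : Row_F1xf) (hR : SocketSlack) : ScenarioCensus.Row_F1 := by
  unfold ScenarioCensus.Row_F1
  intro ν T hν hT u p hsol hLH hdec hTI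
  by_contra hext
  rcases hR ν T hν hT u p ⟨hsol, hext⟩ hLH hdec hTI with h | h
  · exact hext (hS ν T hν hT u p hsol hLH hdec hTI h)
  · exact hext (hX ν T hν hT u p hsol hLH hdec hTI h)

/-- Row F1 ⇒ the residual (vacuously). -/
theorem socketSlack_of_rowF1 (h : ScenarioCensus.Row_F1) : SocketSlack :=
  fun ν T hν hT u p hmax hLH hdec hTI => (hmax.2 (h ν T hν hT u p hmax.1 hLH hdec hTI)).elim

/-! ### Dictionary: the numbers = `ν^{7/2} ×` the normalised `[t₀,T)`-top integrands of `spdOf κ` / `xflOf κ`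
(pure algebra: no regularity, no equation) -/

/-- The speed read-out of the `ν`-normalised data. -/
theorem nu_readout_spdOf {ν σ : ℝ} (hν : 0 < ν) (hσ : 0 < σ) (κ : ℝ) (v : E3) (L : E3 →L[ℝ] E3) (H : Hess)
    (K : E3 →L[ℝ] E3) :
    spdOf κ (ν * σ) (ν⁻¹ • v) (ν⁻¹ • L) (ν⁻¹ • H) (ν⁻¹ • K) =
      (ν ^ 4)⁻¹ * ((σ ^ 2)⁻¹ * (‖v‖ ^ 2 - κ * (ν * σ⁻¹))) := by
  simp only [spdOf, norm_smul, Real.norm_eq_abs, abs_of_pos (inv_pos.2 hν)]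
  have hν' : ν ≠ 0 := hν.ne'
  have hσ' : σ ≠ 0 := hσ.ne'
  field_simp

/-- The cross-flow read-out of the `ν`-normalised data. -/
theorem nu_readout_xflOf {ν σ : ℝ} (hν : 0 < ν) (hσ : 0 < σ) (κ : ℝ) (v : E3) (L : E3 →L[ℝ] E3) (H : Hess)
    (K : E3 →L[ℝ] E3) :
    xflOf κ (ν * σ) (ν⁻¹ • v) (ν⁻¹ • L) (ν⁻¹ • H) (ν⁻¹ • K) =
      (ν ^ 4)⁻¹ * (‖cross (curlCLM L) v‖ ^ 2 - κ * (ν * σ⁻¹ * ‖curlCLM L‖ ^ 2)) := by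
  simp only [xflOf, map_smul, UnthreadedRigidity.ThreadingJets.cross_smul_smul, norm_smul, Real.norm_eq_abs, abs_of_pos (inv_pos.2 hν),
    abs_of_pos (mul_pos (inv_pos.2 hν) (inv_pos.2 hν))]
  have hν' : ν ≠ 0 := hν.ne'
  have hσ' : σ ≠ 0 := hσ.ne'
  field_simp

/-- `topIntegrandτ(spdOf κ) = ofReal(√ν · ν⁻⁴) · spdIntegrand` pointwise. -/
theorem topIntegrandτ_spdOf_eq {ν T : ℝ} (hν : 0 < ν) (κ t₀ : ℝ) (Λ : ℝ → ℝ) (u : ℝ → E3 → E3) (z : ℝ × E3) :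
    topIntegrandτ T ν t₀ Λ (spdOf κ) u z = ENNReal.ofReal (Real.sqrt ν * (ν ^ 4)⁻¹) * spdIntegrand T ν κ t₀ Λ u z := by
  by_cases hz : z ∈ {z : ℝ × E3 | z.1 ∈ Ico t₀ T ∧ Λ z.1 < ‖u z.1 z.2‖}
  · have hσ : 0 < T - z.1 := sub_pos.2 hz.1.2
    rw [topIntegrandτ, spdIntegrand, indicator_of_mem hz, indicator_of_mem hz,
      ← ENNReal.ofReal_mul (mul_nonneg (Real.sqrt_nonneg ν) (inv_nonneg.2 (pow_nonneg hν.le 4)))]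
    congr 1
    have hmax : ∀ P : ℝ, max 0 ((ν ^ 4)⁻¹ * P) = (ν ^ 4)⁻¹ * max 0 P := fun P => by
      rw [mul_max_of_nonneg _ _ (inv_nonneg.2 (pow_nonneg hν.le 4)), mul_zero]
    rw [nu_readout_spdOf hν hσ, Real.sqrt_mul hν.le, hmax]
    ring
  · rw [topIntegrandτ, spdIntegrand, indicator_of_notMem hz, indicator_of_notMem hz, mul_zero]

/-- `topIntegrandτ(xflOf κ) = ofReal(√ν · ν⁻⁴) · xflIntegrand` pointwise. -/
theorem topIntegrandτ_xflOf_eq {ν T : ℝ} (hν : 0 < ν) (κ t₀ : ℝ) (Λ : ℝ → ℝ) (u : ℝ → E3 → E3) (z : ℝ × E3) :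
    topIntegrandτ T ν t₀ Λ (xflOf κ) u z = ENNReal.ofReal (Real.sqrt ν * (ν ^ 4)⁻¹) * xflIntegrand T ν κ t₀ Λ u z := by
  by_cases hz : z ∈ {z : ℝ × E3 | z.1 ∈ Ico t₀ T ∧ Λ z.1 < ‖u z.1 z.2‖}
  · have hσ : 0 < T - z.1 := sub_pos.2 hz.1.2
    rw [topIntegrandτ, xflIntegrand, indicator_of_mem hz, indicator_of_mem hz,
      ← ENNReal.ofReal_mul (mul_nonneg (Real.sqrt_nonneg ν) (inv_nonneg.2 (pow_nonneg hν.le 4)))]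
    congr 1
    have hmax : ∀ P : ℝ, max 0 ((ν ^ 4)⁻¹ * P) = (ν ^ 4)⁻¹ * max 0 P := fun P => by
      rw [mul_max_of_nonneg _ _ (inv_nonneg.2 (pow_nonneg hν.le 4)), mul_zero]
    have hc : curlCLM (fderiv ℝ (u z.1) z.2) = curl (u z.1) z.2 := rfl
    rw [nu_readout_xflOf hν hσ, hc, Real.sqrt_mul hν.le, hmax]
    ring
  · rw [topIntegrandτ, xflIntegrand, indicator_of_notMem hz, indicator_of_notMem hz, mul_zero]

/-- `∫ topIntegrandτ(spdOf κ) = ν^{-7/2} ∫ spdIntegrand`. -/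
theorem lintegral_topIntegrandτ_spdOf_eq {ν T : ℝ} (hν : 0 < ν) (κ t₀ : ℝ) (Λ : ℝ → ℝ) (u : ℝ → E3 → E3) :
    ∫⁻ z, topIntegrandτ T ν t₀ Λ (spdOf κ) u z =
      ENNReal.ofReal (Real.sqrt ν * (ν ^ 4)⁻¹) * ∫⁻ z, spdIntegrand T ν κ t₀ Λ u z := by
  rw [← lintegral_const_mul' _ _ ENNReal.ofReal_ne_top]
  exact lintegral_congr fun z => topIntegrandτ_spdOf_eq hν κ t₀ Λ u z

/-- `∫ topIntegrandτ(xflOf κ) = ν^{-7/2} ∫ xflIntegrand`. -/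
theorem lintegral_topIntegrandτ_xflOf_eq {ν T : ℝ} (hν : 0 < ν) (κ t₀ : ℝ) (Λ : ℝ → ℝ) (u : ℝ → E3 → E3) :
    ∫⁻ z, topIntegrandτ T ν t₀ Λ (xflOf κ) u z =
      ENNReal.ofReal (Real.sqrt ν * (ν ^ 4)⁻¹) * ∫⁻ z, xflIntegrand T ν κ t₀ Λ u z := by
  rw [← lintegral_const_mul' _ _ ENNReal.ofReal_ne_top]
  exact lintegral_congr fun z => topIntegrandτ_xflOf_eq hν κ t₀ Λ u z

/-- The speed-excess integrand is ANTITONE in `κ` (a larger allowance charges less). -/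
theorem spdIntegrand_mono {κ κ' : ℝ} (h : κ ≤ κ') {T ν : ℝ} (hν : 0 ≤ ν) (t₀ : ℝ) (Λ : ℝ → ℝ) (u : ℝ → E3 → E3)
    (z : ℝ × E3) : spdIntegrand T ν κ' t₀ Λ u z ≤ spdIntegrand T ν κ t₀ Λ u z := by
  unfold spdIntegrand
  by_cases hz : z ∈ {z : ℝ × E3 | z.1 ∈ Ico t₀ T ∧ Λ z.1 < ‖u z.1 z.2‖}
  · rw [indicator_of_mem hz, indicator_of_mem hz]
    have hσ : 0 < T - z.1 := sub_pos.2 hz.1.2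
    refine ENNReal.ofReal_le_ofReal (mul_le_mul_of_nonneg_left (max_le_max le_rfl
      (mul_le_mul_of_nonneg_left ?_ (inv_nonneg.2 (sq_nonneg _)))) (Real.sqrt_nonneg _))
    have : 0 ≤ ν * (T - z.1)⁻¹ := mul_nonneg hν (inv_nonneg.2 hσ.le)
    nlinarith
  · rw [indicator_of_notMem hz, indicator_of_notMem hz]

/-! ### Both rows are EXCLUDED (the socket with the two imported kills); the floors; the residual ≡ `Row_F1` -/

/-- **Criterion row F1sp is EXCLUDED** (in kernel): the socket `rowOf_of_kills` with the admissible read-out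
`spdOf κ₊` (`κ₊ = max κ 0`) and the imported time-constant kill `kills_spdOf`. -/
theorem rowF1sp_holds : Row_F1sp := by
  intro ν T hν hT u p hsol hLH hdec hTI htop
  obtain ⟨κ, t₀, Λ, hκ, ht₀, ht₀T, hΛ, hΛm, hfinP⟩ := htop
  have hκ' : max κ 0 < 1 := max_lt hκ zero_lt_one
  have hfin : ∫⁻ z, topIntegrandτ T ν t₀ Λ (spdOf (max κ 0)) u z < ⊤ := by
    rw [lintegral_topIntegrandτ_spdOf_eq hν]
    refine ENNReal.mul_lt_top ENNReal.ofReal_lt_top (lt_of_le_of_lt ?_ hfinP)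
    exact lintegral_mono fun z => spdIntegrand_mono (le_max_left κ 0) hν.le t₀ Λ u z
  exact rowOf_of_kills (isAdmissible_spdOf (le_max_right κ 0)) (kills_spdOf hκ') ν T hν hT u p hsol hLH hdec hTI
    ⟨t₀, Λ, ht₀, ht₀T, hΛ, hΛm, hfin⟩

/-- **Criterion row F1xf is EXCLUDED** (in kernel): the socket with the admissible read-out `xflOf κ` and the imported
cross-flow kill `kills_xflOf`. -/
theorem rowF1xf_holds : Row_F1xf := by
  intro ν T hν hT u p hsol hLH hdec hTI htop
  obtain ⟨κ, t₀, Λ, hκ, ht₀, ht₀T, hΛ, hΛm, hfinP⟩ := htop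
  have hfin : ∫⁻ z, topIntegrandτ T ν t₀ Λ (xflOf κ) u z < ⊤ := by
    rw [lintegral_topIntegrandτ_xflOf_eq hν]
    exact ENNReal.mul_lt_top ENNReal.ofReal_lt_top hfinP
  exact rowOf_of_kills (isAdmissible_xflOf κ) (kills_xflOf hκ) ν T hν hT u p hsol hLH hdec hTI
    ⟨t₀, Λ, ht₀, ht₀T, hΛ, hΛm, hfin⟩

/-- **The floor DIVERGENT SPEED EXCESS holds.** -/
theorem divergentSpeedExcess_holds : DivergentSpeedExcess := by
  intro ν T hν hT u p hmax hLH hdec hTI κ hκ t₀ ht₀ ht₀T Λ hΛ hΛm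
  by_contra hne
  exact hmax.2 (rowF1sp_holds ν T hν hT u p hmax.1 hLH hdec hTI
    ⟨κ, t₀, Λ, hκ, ht₀, ht₀T, hΛ, hΛm, lt_top_iff_ne_top.2 hne⟩)

/-- **The floor DIVERGENT CROSS-FLOW EXCESS holds.** -/
theorem divergentCrossFlowExcess_holds : DivergentCrossFlowExcess := by
  intro ν T hν hT u p hmax hLH hdec hTI κ hκ t₀ ht₀ ht₀T Λ hΛ hΛm
  by_contra hne
  exact hmax.2 (rowF1xf_holds ν T hν hT u p hmax.1 hLH hdec hTI
    ⟨κ, t₀, Λ, hκ, ht₀, ht₀T, hΛ, hΛm, lt_top_iff_ne_top.2 hne⟩)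

/-- **THE TWO NEW FLOORS** (structural theorem, maximal frame): for a maximal Type-I Clay blow-up, on the fast set of
EVERY measurable subcritical level and on every `[t₀, T)`, BOTH the SPEED of the fast fluid AND ITS CROSS-FLOW SPEED
(the speed at which it crosses its own vortex lines, enstrophy-weighted) exceed every fraction `κ < 1` of the
self-similar speed `√(ν/(T − t))` NON-INTEGRABLY in the scale-invariant measures above.  PROVED. -/
theorem socketFloors_holds : DivergentSpeedExcess ∧ DivergentCrossFlowExcess :=
  ⟨divergentSpeedExcess_holds, divergentCrossFlowExcess_holds⟩

/-- The residual is EXACTLY row F1 (declared; no movement on `Row_F1` is claimed). -/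
theorem socketSlack_iff_rowF1 : SocketSlack ↔ ScenarioCensus.Row_F1 :=
  ⟨rowF1_of rowF1sp_holds rowF1xf_holds, socketSlack_of_rowF1⟩

/-- Row F1 from the residual alone (both criterion rows being proved). -/
theorem rowF1_of_socketSlack (h : SocketSlack) : ScenarioCensus.Row_F1 :=
  rowF1_of rowF1sp_holds rowF1xf_holds h

end Summit.NavierStokesRegularity.NavierStokesRegularity.Theorems.ScenarioCensus.LiouvilleSocket

end
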